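import Literature.NumberTheory.QuadraticFields.ClassNumbersUpToOneHundred
import Literature.NumberTheory.QuadraticFields.ImaginaryQuadraticClassNumberValues
import Literature.NumberTheory.QuadraticFields.KroneckerSplitting
import Mathlib.Tactic.NormNum.LegendreSymbol
import HarnessLib

/-!
# Imaginary quadratic fields in which `2`, `3` and `5` all split have class number at least `5`
# (modulo Watkins' Table 4)

Topic `NumberTheory/QuadraticFields`, namespace `Literature.NumberTheory.QuadraticFields.SmallClassNumberSplit`
(beside `ClassNumbersUpToOneHundred.lean` — Watkins' named fact `watkins2004_table4` and its readings —,
`ImaginaryQuadraticClassNumberValues.lean` — kernel values of the form class number `Quadratic.BinQF.classNumber`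
and the field-side bridge `ClassNumberValues.classNumber_eq_of_discr_eq` — and `KroneckerSplitting.lean` — the
decomposition laws `Quadratic.ncard_primesOver_two_eq_two_iff`, `Quadratic.ncard_primesOver_eq_two_iff_jacobiSym`).
THEOREMS ONLY (no definition, no new named fact).

Main statement `five_le_classNumber_of_split_two_three_five`: modulo Watkins 2004 Table 4 (the class number
`≤ 100` problem), an imaginary quadratic field `K` in which the primes `2`, `3`, `5` all split (two primes of `𝓞 K`
above each) has `h_K ≥ 5`. Proof: if `h_K ≤ 4` then `|d_K| ≤ large(h_K) ≤ 1555` (Table 4 rows 1–4: `163, 427, 907,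
1555`); splitting of `2, 3, 5` reads `d_K ≡ 1 (mod 8)`, `d_K ≡ 1 (mod 3)`, `d_K ≡ ±1 (mod 5)`; and the KERNEL table
`five_le_binQF_classNumber_table` (`decide +kernel` over `−1555 ≤ D ≤ −5`, the class number being evaluated only at
the 25 qualifying `D ≡ 1, 49 (mod 120)`: `h(−71) = 7`, `h(−119) = 10`, …, `h(−1511)`) gives `h(d_K) ≥ 5` —
contradiction. Equivalently: NONE of the 97 imaginary quadratic fields of class number `≤ 4` has `2`, `3` and `5`
split. Consumer: the BSD cell `pub/bsd-wall`, crux `HeegnerTwistCouplingInSupply` (a Heegner field for a level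
`N` with `30 ∣ N` has `h ≥ 5`, so at `p = 5` the coupling-free regime `h(K′) < p` is empty there).
§5 (same method, Table 4 rows 1–6, `|d_K| ≤ 3763`, 65 kernel values): the ONLY imaginary quadratic field in which
`2`, `3`, `7` all split and `h_K ≤ 6` is `ℚ(√−47)` (`h = 5`) — `discr_eq_neg47_of_split_two_three_seven`.

## References

* M. Watkins, *Class numbers of imaginary quadratic fields*, Math. Comp. 73 (2004) 907–938, Table 4 p. 936.
  [Watkins2004ClassNumbers]
* D. A. Cox, *Primes of the form x² + ny²*, 2nd ed., Wiley 2013, Thm. 2.13, Thm. 7.7(ii). [Cox2013]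
* D. A. Marcus, *Number Fields*, Ch. 3 Thm. 25 (decomposition of primes in quadratic fields). [folklore]
-/

set_option autoImplicit false

namespace Literature.NumberTheory.QuadraticFields.SmallClassNumberSplit

open scoped NumberField

open Literature.NumberTheory.QuadraticFields Literature.NumberTheory.QuadraticFields.Quadratic Ideal

/-! ### §1 The kernel table: `h(D) ≥ 5` for `−1555 ≤ D ≤ −5`, `D ≡ 1 (mod 24)`, `D ≡ ±1 (mod 5)` -/

/-- **Kernel table.** For every integer `−1555 ≤ D ≤ −5` with `D ≡ 1 (mod 8)`, `D ≡ 1 (mod 3)` and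
`D ≡ 1` or `4 (mod 5)` (the 25 values `D ≡ 1, 49 (mod 120)`: `−71, −119, −191, …, −1511`), the form class number
`h(D)` (`Quadratic.BinQF.classNumber`, number of reduced primitive positive definite forms) is at least `5`.
Decided by the kernel. [cite: Cox2013, §2.A Thm. 2.13] -/
theorem five_le_binQF_classNumber_table :
    ∀ D ∈ Finset.Icc (-1555 : ℤ) (-5), D % 8 = 1 → D % 3 = 1 → (D % 5 = 1 ∨ D % 5 = 4) →
      5 ≤ BinQF.classNumber D := by
  decide +kernel

/-! ### §2 Residues from splitting -/

/-- `J(a | 3) = 1 ⇒ a ≡ 1 (mod 3)` (the only non-zero square mod `3` is `1`). [folklore] -/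
private theorem emod_three_eq_one_of_jacobiSym_eq_one {a : ℤ} (h : jacobiSym a 3 = 1) : a % 3 = 1 := by
  rw [jacobiSym.mod_left a 3] at h
  have h0 : 0 ≤ a % 3 := Int.emod_nonneg a (by norm_num)
  have h3 : a % 3 < 3 := Int.emod_lt_of_pos a (by norm_num)
  interval_cases hr : a % 3
  · norm_num at h
  · rfl
  · norm_num at h

/-- `J(a | 5) = 1 ⇒ a ≡ 1` or `4 (mod 5)` (the non-zero squares mod `5`). [folklore] -/
private theorem emod_five_of_jacobiSym_eq_one {a : ℤ} (h : jacobiSym a 5 = 1) : a % 5 = 1 ∨ a % 5 = 4 := by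
  rw [jacobiSym.mod_left a 5] at h
  have h0 : 0 ≤ a % 5 := Int.emod_nonneg a (by norm_num)
  have h5 : a % 5 < 5 := Int.emod_lt_of_pos a (by norm_num)
  interval_cases hr : a % 5
  · norm_num at h
  · exact Or.inl rfl
  · norm_num at h
  · norm_num at h
  · exact Or.inr rfl

/-! ### §3 Watkins rows 1–4 -/

/-- `large(N) ≤ 1555` for `N ≤ 4` (Table 4 rows `163, 427, 907, 1555`; `large(0) = 0`).
[cite: Watkins2004ClassNumbers, Table 4 p. 936] -/
theorem largest_le_1555 {N : ℕ} (hN : N ≤ 4) : Watkins2004.largest N ≤ 1555 := by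
  interval_cases N <;> decide

/-! ### §4 The theorem -/

variable {K : Type} [Field K] [NumberField K]

/-- **`h_K = h(d_K)`** (Cox Thm. 2.13 + Thm. 7.7(ii), through the tree's kernel encoding
`Quadratic.BinQF.classNumber`). [cite: Cox2013, §7.B Thm. 7.7(ii)] -/
theorem classNumber_eq_binQF_classNumber (h2 : Module.finrank ℚ K = 2) (hd : NumberField.discr K < 0) :
    NumberField.classNumber K = BinQF.classNumber (NumberField.discr K) :=
  ClassNumberValues.classNumber_eq_of_discr_eq h2 (D := NumberField.discr K) rfl hd
    (h := BinQF.classNumber (NumberField.discr K)) rfl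

/-- **Imaginary quadratic fields in which `2`, `3`, `5` all split have `h_K ≥ 5`** (modulo Watkins' Table 4).
For a number field `K` with `[K:ℚ] = 2`, `d_K < 0`, and exactly two primes of `𝓞 K` above each of `2`, `3`, `5`:
`5 ≤ h_K`. Equivalently no imaginary quadratic field of class number `≤ 4` has `2`, `3`, `5` all split.
Proof: `h_K ≤ 4 ⇒ |d_K| ≤ 1555` (Table 4), `d_K ≡ 1 (mod 8)`, `≡ 1 (mod 3)`, `≡ ±1 (mod 5)` (decomposition
laws), and the kernel table of §1. [cite: Watkins2004ClassNumbers, Table 4 p. 936 with §8 p. 935] -/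
theorem five_le_classNumber_of_split_two_three_five (hW : watkins2004_table4)
    (h2 : Module.finrank ℚ K = 2) (hd : NumberField.discr K < 0)
    (hs2 : ((span {(2 : ℤ)}).primesOver (𝓞 K)).ncard = 2)
    (hs3 : ((span {((3 : ℕ) : ℤ)}).primesOver (𝓞 K)).ncard = 2)
    (hs5 : ((span {((5 : ℕ) : ℤ)}).primesOver (𝓞 K)).ncard = 2) :
    5 ≤ NumberField.classNumber K := by
  by_contra hlt
  have h4 : NumberField.classNumber K ≤ 4 := by omega
  -- `|d_K| ≤ 1555`
  have hle : (NumberField.discr K).natAbs ≤ 1555 :=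
    (Watkins2004.natAbs_discr_le_largest hW K h2 hd (by omega)).trans (largest_le_1555 h4)
  -- residues of `d_K`
  have h8 : NumberField.discr K % 8 = 1 := (ncard_primesOver_two_eq_two_iff h2).1 hs2
  have hj3 : jacobiSym (NumberField.discr K) 3 = 1 :=
    (ncard_primesOver_eq_two_iff_jacobiSym h2 Nat.prime_three (by norm_num)).1 hs3
  have hj5 : jacobiSym (NumberField.discr K) 5 = 1 :=
    (ncard_primesOver_eq_two_iff_jacobiSym h2 Nat.prime_five (by norm_num)).1 hs5
  have hm3 := emod_three_eq_one_of_jacobiSym_eq_one hj3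
  have hm5 := emod_five_of_jacobiSym_eq_one hj5
  -- `d_K ≤ -5`: `d_K < 0`, `d_K ≡ 1 (mod 8)` (so `d_K ≤ -7`)
  have hmem : NumberField.discr K ∈ Finset.Icc (-1555 : ℤ) (-5) := by
    rw [Finset.mem_Icc]
    omega
  have h5 := five_le_binQF_classNumber_table _ hmem h8 hm3 hm5
  rw [← classNumber_eq_binQF_classNumber h2 hd] at h5
  omega


/-! ### §5 `p = 7`: the only imaginary quadratic field with `2`, `3`, `7` split and `h ≤ 6` is `ℚ(√−47)` -/

/-- **Kernel table (`p = 7`).** For every integer `−3763 ≤ D ≤ −5` with `D ≡ 1 (mod 8)`, `D ≡ 1 (mod 3)`,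
`D ≡ 1, 2` or `4 (mod 7)` (the squares mod `7`) and `D ≠ −47`, the form class number `h(D)` is at least `7`
(`decide +kernel`; the class number is evaluated at the 65-odd qualifying `D ≡ 1 (mod 24)` only). [cite: Cox2013, §2.A Thm. 2.13] -/
theorem seven_le_binQF_classNumber_table :
    ∀ D ∈ Finset.Icc (-3763 : ℤ) (-5), D % 8 = 1 → D % 3 = 1 → (D % 7 = 1 ∨ D % 7 = 2 ∨ D % 7 = 4) → D ≠ -47 →
      7 ≤ BinQF.classNumber D := by
  decide +kernel

/-- `J(a | 7) = 1 ⇒ a ≡ 1, 2, 4 (mod 7)` (the non-zero squares mod `7`). [folklore] -/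
private theorem emod_seven_of_jacobiSym_eq_one {a : ℤ} (h : jacobiSym a 7 = 1) :
    a % 7 = 1 ∨ a % 7 = 2 ∨ a % 7 = 4 := by
  rw [jacobiSym.mod_left a 7] at h
  have h0 : 0 ≤ a % 7 := Int.emod_nonneg a (by norm_num)
  have h7 : a % 7 < 7 := Int.emod_lt_of_pos a (by norm_num)
  interval_cases hr : a % 7
  · norm_num at h
  · exact Or.inl rfl
  · exact Or.inr (Or.inl rfl)
  · norm_num at h
  · exact Or.inr (Or.inr rfl)
  · norm_num at h
  · norm_num at h

/-- `large(N) ≤ 3763` for `N ≤ 6` (Table 4 rows `163, 427, 907, 1555, 2683, 3763`).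
[cite: Watkins2004ClassNumbers, Table 4 p. 936] -/
theorem largest_le_3763 {N : ℕ} (hN : N ≤ 6) : Watkins2004.largest N ≤ 3763 := by
  interval_cases N <;> decide

/-- **The only imaginary quadratic field with `2`, `3`, `7` split and `h_K ≤ 6` is `ℚ(√−47)`** (modulo Watkins'
Table 4): for `[K:ℚ] = 2`, `d_K < 0`, two primes above each of `2, 3, 7`, and `h_K ≤ 6`: `d_K = −47` (and then
`h_K = 5`, `classNumber_eq_five_of_split_two_three_seven`). Proof: `|d_K| ≤ 3763` (rows 1–6), residues `d_K ≡ 1 (8)`,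
`≡ 1 (3)`, `∈ {1,2,4} (7)`, and the kernel table of §5. [cite: Watkins2004ClassNumbers, Table 4 p. 936 with §8 p. 935] -/
theorem discr_eq_neg47_of_split_two_three_seven (hW : watkins2004_table4)
    (h2 : Module.finrank ℚ K = 2) (hd : NumberField.discr K < 0)
    (hs2 : ((span {(2 : ℤ)}).primesOver (𝓞 K)).ncard = 2)
    (hs3 : ((span {((3 : ℕ) : ℤ)}).primesOver (𝓞 K)).ncard = 2)
    (hs7 : ((span {((7 : ℕ) : ℤ)}).primesOver (𝓞 K)).ncard = 2)
    (h6 : NumberField.classNumber K ≤ 6) :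
    NumberField.discr K = -47 := by
  by_contra hne
  have hle : (NumberField.discr K).natAbs ≤ 3763 :=
    (Watkins2004.natAbs_discr_le_largest hW K h2 hd (by omega)).trans (largest_le_3763 h6)
  have h8 : NumberField.discr K % 8 = 1 := (ncard_primesOver_two_eq_two_iff h2).1 hs2
  have hj3 : jacobiSym (NumberField.discr K) 3 = 1 :=
    (ncard_primesOver_eq_two_iff_jacobiSym h2 Nat.prime_three (by norm_num)).1 hs3
  have hprime7 : Nat.Prime 7 := by norm_num
  have hj7 : jacobiSym (NumberField.discr K) 7 = 1 :=
    (ncard_primesOver_eq_two_iff_jacobiSym h2 hprime7 (by norm_num)).1 hs7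
  have hm3 := emod_three_eq_one_of_jacobiSym_eq_one hj3
  have hm7 := emod_seven_of_jacobiSym_eq_one hj7
  have hmem : NumberField.discr K ∈ Finset.Icc (-3763 : ℤ) (-5) := by
    rw [Finset.mem_Icc]
    omega
  have h7 := seven_le_binQF_classNumber_table _ hmem h8 hm3 hm7 hne
  rw [← classNumber_eq_binQF_classNumber h2 hd] at h7
  omega

/-- … and then `h_K = 5`. [cite: Watkins2004ClassNumbers, Table 4 p. 936] [cite: Cox2013, §7.B Thm. 7.7(ii)] -/
theorem classNumber_eq_five_of_split_two_three_seven (hW : watkins2004_table4)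
    (h2 : Module.finrank ℚ K = 2) (hd : NumberField.discr K < 0)
    (hs2 : ((span {(2 : ℤ)}).primesOver (𝓞 K)).ncard = 2)
    (hs3 : ((span {((3 : ℕ) : ℤ)}).primesOver (𝓞 K)).ncard = 2)
    (hs7 : ((span {((7 : ℕ) : ℤ)}).primesOver (𝓞 K)).ncard = 2)
    (h6 : NumberField.classNumber K ≤ 6) :
    NumberField.classNumber K = 5 :=
  ClassNumberValues.classNumber_eq_of_discr_eq h2
    (discr_eq_neg47_of_split_two_three_seven hW h2 hd hs2 hs3 hs7 h6) (by norm_num) ClassNumberValues.classNumber_neg47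

/-- **Dichotomy at `p = 7`** (modulo Watkins' Table 4): an imaginary quadratic field with `2, 3, 7` split has
`h_K ≥ 7` or is `ℚ(√−47)`. [cite: Watkins2004ClassNumbers, Table 4 p. 936] -/
theorem seven_le_classNumber_or_discr_eq_neg47 (hW : watkins2004_table4)
    (h2 : Module.finrank ℚ K = 2) (hd : NumberField.discr K < 0)
    (hs2 : ((span {(2 : ℤ)}).primesOver (𝓞 K)).ncard = 2)
    (hs3 : ((span {((3 : ℕ) : ℤ)}).primesOver (𝓞 K)).ncard = 2)
    (hs7 : ((span {((7 : ℕ) : ℤ)}).primesOver (𝓞 K)).ncard = 2) :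
    7 ≤ NumberField.classNumber K ∨ NumberField.discr K = -47 := by
  by_cases h6 : NumberField.classNumber K ≤ 6
  · exact Or.inr (discr_eq_neg47_of_split_two_three_seven hW h2 hd hs2 hs3 hs7 h6)
  · exact Or.inl (by omega)

end Literature.NumberTheory.QuadraticFields.SmallClassNumberSplit
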